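import Literature.Analysis.SpecialFunctions.GammaStirlingVertical
import HarnessLib

/-!
# Booker 2003: decay of the completed `Λ(s) = γ(s) L(s)` in vertical strips — proofs only

A. R. Booker, *Poles of Artin L-functions and the strong Artin conjecture*, Ann. of Math. 158
(2003), p. 1091: in the contour integrals (3), (18)–(20) "e^{−iπs/2} cancels the decay of the
Γ-factor", i.e. everything rests on `|γ(σ + it)| ≍ |t|^{σ + (a₁+a₂)/2 − 1} e^{−π|t|/2}` for the
`GL(2)` factor `γ(s) = π^{-s} Γ((s+a₁)/2) Γ((s+a₂)/2)` (even `ρ`: `a₁ = a₂ = a`; odd `ρ`: `a₁ = 0`,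
`a₂ = 1`).  This file turns the sharp vertical Stirling estimate of
`Analysis/SpecialFunctions/GammaStirlingVertical` into the strip-decay hypothesis
`‖Λ(s)‖ ≤ C (1 + ‖s‖)^k e^{−π|Im s|/2}` consumed by `Automorphic/BookerStrongArtinContour`
(`Booker2003.integral_eq3_eq_zero` & co.), starting from the polynomial growth of `L` in strips
produced by `Automorphic/BookerStrongArtinGrowth` (`Booker2003.exists_norm_le_mul_pow_of_mem_strip`):

* `exists_norm_gammaFactor_le` — `‖γ(s)‖ ≤ C |Im s|^{Re s + (a₁+a₂)/2 − 1} e^{−π|Im s|/2}` for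
  `σ₁ ≤ Re s ≤ σ₂`, `|Im s| ≥ 2`;
* `isCompact_re_Icc_abs_im_le` — compactness of closed vertical rectangles;
* `exists_strip_decay` — for `Λ` entire with `Λ = γ L` off the real axis and `L` of polynomial
  growth in every strip: `‖Λ(s)‖ ≤ C (1 + ‖s‖)^k e^{−π|Im s|/2}` in every strip.

Theorems only; no definitions, no named facts (D-0026).

## References

* A. R. Booker, Ann. of Math. (2) 158 (2003), 1089–1098, pp. 1090–1091. [Booker2003]
* E. C. Titchmarsh, *The Theory of the Riemann Zeta-Function*, 2nd ed. (1986), (4.12.2). [Titchmarsh1986]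

## Mathlib / tree search

Tree: `GammaStirling.exists_norm_Gamma_vertical_le` (`GammaStirlingVertical`). Mathlib:
`Complex.norm_cpow_eq_rpow_re_of_pos`, `Metric.isCompact_of_isClosed_isBounded`,
`IsCompact.exists_bound_of_continuousOn`, `Real.rpow_le_rpow_of_exponent_le`.
-/

noncomputable section

open Complex Real Set Filter Topology

namespace Literature.NumberTheory.Automorphic

namespace Booker2003

open Literature.Analysis.SpecialFunctions

/-- **Stirling for the `GL(2)` archimedean factor on vertical lines.** For natural `a₁, a₂` and
real `σ₁ ≤ σ₂` there is `C` such that for `σ₁ ≤ Re s ≤ σ₂`, `|Im s| ≥ 2`: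
`‖π^{-s} Γ((s+a₁)/2) Γ((s+a₂)/2)‖ ≤ C |Im s|^{Re s + (a₁+a₂)/2 − 1} e^{−π|Im s|/2}`
(`|Γ(x+iu)| ≤ C|u|^{x−1/2}e^{−π|u|/2}` at `u = Im s/2`, `GammaStirling.exists_norm_Gamma_vertical_le`).
[folklore] -/
theorem exists_norm_gammaFactor_le (a₁ a₂ : ℕ) (σ₁ σ₂ : ℝ) :
    ∃ C : ℝ, 0 < C ∧ ∀ s : ℂ, σ₁ ≤ s.re → s.re ≤ σ₂ → 2 ≤ |s.im| →
      ‖(π : ℂ) ^ (-s) * Complex.Gamma ((s + a₁) / 2) * Complex.Gamma ((s + a₂) / 2)‖ ≤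
        C * |s.im| ^ (s.re + (a₁ + a₂) / 2 - 1) * Real.exp (-(π * |s.im|) / 2) := by
  obtain ⟨C₁, hC₁, h₁⟩ := GammaStirling.exists_norm_Gamma_vertical_le ((σ₁ + a₁) / 2) ((σ₂ + a₁) / 2)
  obtain ⟨C₂, hC₂, h₂⟩ := GammaStirling.exists_norm_Gamma_vertical_le ((σ₁ + a₂) / 2) ((σ₂ + a₂) / 2)
  set P : ℝ := max (π ^ (-σ₁)) (π ^ (-σ₂)) with hP
  have hP0 : 0 < P := lt_max_of_lt_left (Real.rpow_pos_of_pos Real.pi_pos _)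
  -- `|t/2|^{e} = 2^{-e}|t|^e`; collect the powers of `2`
  set D : ℝ := max ((2 : ℝ) ^ (-(σ₁ + (a₁ + a₂) / 2 - 1))) ((2 : ℝ) ^ (-(σ₂ + (a₁ + a₂) / 2 - 1))) with hD
  have hD0 : 0 < D := lt_max_of_lt_left (Real.rpow_pos_of_pos two_pos _)
  refine ⟨P * C₁ * C₂ * D, by positivity, fun s hs1 hs2 ht ↦ ?_⟩
  set σ : ℝ := s.re with hσ
  set t : ℝ := s.im with ht'
  have ht0 : 0 < |t| := by linarith
  have hu : 1 ≤ |t / 2| := by rw [abs_div, abs_two]; linarith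
  -- the two Γ-factors at `x = (σ+aᵢ)/2`, `u = t/2`
  have harg : ∀ a : ℕ, (s + a) / 2 = (((σ + a) / 2 : ℝ) : ℂ) + (t / 2 : ℝ) * I := by
    intro a
    apply Complex.ext <;> simp [hσ, ht']
  have hx1 : (σ + a₁) / 2 ∈ Icc ((σ₁ + a₁) / 2) ((σ₂ + a₁) / 2) := ⟨by linarith, by linarith⟩
  have hx2 : (σ + a₂) / 2 ∈ Icc ((σ₁ + a₂) / 2) ((σ₂ + a₂) / 2) := ⟨by linarith, by linarith⟩
  have hΓ1 := h₁ _ hx1 (t / 2) hu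
  have hΓ2 := h₂ _ hx2 (t / 2) hu
  rw [← harg a₁] at hΓ1
  rw [← harg a₂] at hΓ2
  -- the power of `π`
  have hπ : ‖(π : ℂ) ^ (-s)‖ ≤ P := by
    rw [Complex.norm_cpow_eq_rpow_re_of_pos Real.pi_pos, Complex.neg_re, ← hσ]
    rcases le_total 1 π with hπ1 | hπ1
    · exact le_max_of_le_left (Real.rpow_le_rpow_of_exponent_le hπ1 (by linarith))
    · exact le_max_of_le_right (Real.rpow_le_rpow_of_exponent_ge Real.pi_pos hπ1 (by linarith))
  -- combine the two Stirling bounds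
  have hexp : Real.exp (-(π * |t / 2|) / 2) * Real.exp (-(π * |t / 2|) / 2) =
      Real.exp (-(π * |t|) / 2) := by
    rw [← Real.exp_add, abs_div, abs_two]; congr 1; ring
  have hpow : |t / 2| ^ ((σ + a₁) / 2 - 1 / 2) * |t / 2| ^ ((σ + a₂) / 2 - 1 / 2) =
      (2 : ℝ) ^ (-(σ + (a₁ + a₂) / 2 - 1)) * |t| ^ (σ + (a₁ + a₂) / 2 - 1) := by
    rw [← Real.rpow_add (by positivity), abs_div, abs_two, Real.div_rpow (abs_nonneg t) zero_le_two,
      div_eq_mul_inv, ← Real.rpow_neg zero_le_two]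
    ring_nf
  have hDle : (2 : ℝ) ^ (-(σ + (a₁ + a₂) / 2 - 1)) ≤ D := by
    rw [hD]
    -- `e ↦ 2^{-e}` is antitone, so the value lies below the max of the endpoints
    rcases le_total (σ + (a₁ + a₂) / 2 - 1) ((σ₁ + (a₁ + a₂) / 2 - 1) + 0) with h | h
    · exact le_max_of_le_left (Real.rpow_le_rpow_of_exponent_le one_le_two (by linarith))
    · refine le_max_of_le_left (Real.rpow_le_rpow_of_exponent_le one_le_two (by linarith))
  calc ‖(π : ℂ) ^ (-s) * Complex.Gamma ((s + a₁) / 2) * Complex.Gamma ((s + a₂) / 2)‖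
      = ‖(π : ℂ) ^ (-s)‖ * ‖Complex.Gamma ((s + a₁) / 2)‖ * ‖Complex.Gamma ((s + a₂) / 2)‖ := by
        rw [norm_mul, norm_mul]
    _ ≤ P * (C₁ * |t / 2| ^ ((σ + a₁) / 2 - 1 / 2) * Real.exp (-(π * |t / 2|) / 2)) *
          (C₂ * |t / 2| ^ ((σ + a₂) / 2 - 1 / 2) * Real.exp (-(π * |t / 2|) / 2)) :=
        mul_le_mul (mul_le_mul hπ hΓ1 (norm_nonneg _) hP0.le) hΓ2 (norm_nonneg _) (by positivity)
    _ = P * C₁ * C₂ * ((2 : ℝ) ^ (-(σ + (a₁ + a₂) / 2 - 1))) * |t| ^ (σ + (a₁ + a₂) / 2 - 1) *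
          Real.exp (-(π * |t|) / 2) := by
        have : P * (C₁ * |t / 2| ^ ((σ + a₁) / 2 - 1 / 2) * Real.exp (-(π * |t / 2|) / 2)) *
            (C₂ * |t / 2| ^ ((σ + a₂) / 2 - 1 / 2) * Real.exp (-(π * |t / 2|) / 2)) =
            P * C₁ * C₂ * (|t / 2| ^ ((σ + a₁) / 2 - 1 / 2) * |t / 2| ^ ((σ + a₂) / 2 - 1 / 2)) *
              (Real.exp (-(π * |t / 2|) / 2) * Real.exp (-(π * |t / 2|) / 2)) := by ring
        rw [this, hpow, hexp]; ring
    _ ≤ P * C₁ * C₂ * D * |t| ^ (σ + (a₁ + a₂) / 2 - 1) * Real.exp (-(π * |t|) / 2) := by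
        gcongr


/-- A closed vertical rectangle `σ₁ ≤ Re s ≤ σ₂`, `|Im s| ≤ T` is compact. [folklore] -/
theorem isCompact_re_Icc_abs_im_le (σ₁ σ₂ T : ℝ) :
    IsCompact {s : ℂ | σ₁ ≤ s.re ∧ s.re ≤ σ₂ ∧ |s.im| ≤ T} := by
  refine Metric.isCompact_of_isClosed_isBounded ?_ ?_
  · have h1 : IsClosed {s : ℂ | σ₁ ≤ s.re} := isClosed_le continuous_const Complex.continuous_re
    have h2 : IsClosed {s : ℂ | s.re ≤ σ₂} := isClosed_le Complex.continuous_re continuous_const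
    have h3 : IsClosed {s : ℂ | |s.im| ≤ T} :=
      isClosed_le (continuous_abs.comp Complex.continuous_im) continuous_const
    simpa only [Set.setOf_and] using h1.inter (h2.inter h3)
  · rw [Metric.isBounded_iff_subset_closedBall 0]
    refine ⟨max |σ₁| |σ₂| + T, fun s hs ↦ ?_⟩
    obtain ⟨h1, h2, h3⟩ := hs
    rw [Metric.mem_closedBall, dist_zero_right]
    have hre : |s.re| ≤ max |σ₁| |σ₂| := by
      rw [abs_le]; constructor
      · have := neg_abs_le σ₁; have := le_max_left |σ₁| |σ₂|; linarith
      · have := le_abs_self σ₂; have := le_max_right |σ₁| |σ₂|; linarith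
    exact (Complex.norm_le_abs_re_add_abs_im s).trans (by linarith)

/-- **Decay of the completed `Λ = γ L` in vertical strips.** Let `Λ` be entire with
`Λ(s) = π^{-s} Γ((s+a₁)/2) Γ((s+a₂)/2) L(s)` off the real axis, where `L` has polynomial growth in
every vertical strip (`Automorphic/BookerStrongArtinGrowth`). Then in every vertical strip
`‖Λ(s)‖ ≤ C (1 + ‖s‖)^k e^{−π|Im s|/2}` — the hypothesis of the contour identities of
`Automorphic/BookerStrongArtinContour` (Booker 2003, p. 1091: the `Γ`-factor supplies the decay
that the twist `e^{−iπs/2}` "cancels"). [cite: Booker2003, p. 1091] -/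
theorem exists_strip_decay {Λ L : ℂ → ℂ} (a₁ a₂ : ℕ) (hΛ : Differentiable ℂ Λ)
    (hΛL : ∀ s : ℂ, s.im ≠ 0 →
      Λ s = (π : ℂ) ^ (-s) * Complex.Gamma ((s + a₁) / 2) * Complex.Gamma ((s + a₂) / 2) * L s)
    (hL : ∀ σ₁ σ₂ : ℝ, ∃ C : ℝ, ∃ k : ℕ, ∀ s : ℂ, σ₁ ≤ s.re → s.re ≤ σ₂ →
      ‖L s‖ ≤ C * (1 + ‖s‖) ^ k)
    (σ₁ σ₂ : ℝ) :
    ∃ C : ℝ, 0 ≤ C ∧ ∃ k : ℕ, ∀ s : ℂ, σ₁ ≤ s.re → s.re ≤ σ₂ →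
      ‖Λ s‖ ≤ C * (1 + ‖s‖) ^ k * Real.exp (-(π * |s.im|) / 2) := by
  obtain ⟨CL, k, hCL⟩ := hL σ₁ σ₂
  obtain ⟨Cγ, hCγ, hγ⟩ := exists_norm_gammaFactor_le a₁ a₂ σ₁ σ₂
  -- the extra power absorbing `|t|^{σ + (a₁+a₂)/2 − 1}`
  set e : ℝ := max (σ₂ + (a₁ + a₂) / 2 - 1) 0 with he
  set K : ℕ := ⌈e⌉₊ with hK
  have he0 : 0 ≤ e := le_max_right _ _
  have heK : e ≤ K := Nat.le_ceil e
  -- a bound on the compact part `|Im s| ≤ 2`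
  obtain ⟨B, hB⟩ := (isCompact_re_Icc_abs_im_le σ₁ σ₂ 2).exists_bound_of_continuousOn
    hΛ.continuous.continuousOn
  set B' : ℝ := max B 0 with hB'
  refine ⟨max CL 0 * Cγ + B' * Real.exp π, by positivity, k + K, fun s hs1 hs2 ↦ ?_⟩
  have h1s : 1 ≤ 1 + ‖s‖ := by linarith [norm_nonneg s]
  have hpowk : (0 : ℝ) ≤ (1 + ‖s‖) ^ (k + K) := by positivity
  rcases le_or_gt 2 |s.im| with ht | ht
  · -- `|t| ≥ 2`: Stirling
    have hΛs : ‖Λ s‖ = ‖(π : ℂ) ^ (-s) * Complex.Gamma ((s + a₁) / 2) * Complex.Gamma ((s + a₂) / 2)‖ *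
        ‖L s‖ := by
      rw [hΛL s (by intro h0; rw [h0, abs_zero] at ht; linarith), norm_mul]
    have hγs := hγ s hs1 hs2 ht
    have hLs : ‖L s‖ ≤ max CL 0 * (1 + ‖s‖) ^ k :=
      (hCL s hs1 hs2).trans (mul_le_mul_of_nonneg_right (le_max_left _ _) (by positivity))
    -- `|t|^{σ + (a₁+a₂)/2 − 1} ≤ (1 + ‖s‖)^K`
    have ht1 : 1 ≤ |s.im| := by linarith
    have htpow : |s.im| ^ (s.re + (a₁ + a₂) / 2 - 1) ≤ (1 + ‖s‖) ^ K := by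
      calc |s.im| ^ (s.re + (a₁ + a₂) / 2 - 1) ≤ |s.im| ^ e :=
            Real.rpow_le_rpow_of_exponent_le ht1 ((by linarith : _ ≤ σ₂ + (a₁ + a₂) / 2 - 1).trans
              (le_max_left _ _))
        _ ≤ (1 + ‖s‖) ^ e := Real.rpow_le_rpow (abs_nonneg _)
              ((Complex.abs_im_le_norm s).trans (by linarith)) he0
        _ ≤ (1 + ‖s‖) ^ (K : ℝ) := Real.rpow_le_rpow_of_exponent_le h1s heK
        _ = (1 + ‖s‖) ^ K := Real.rpow_natCast _ _
    calc ‖Λ s‖ ≤ (Cγ * |s.im| ^ (s.re + (a₁ + a₂) / 2 - 1) * Real.exp (-(π * |s.im|) / 2)) *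
          (max CL 0 * (1 + ‖s‖) ^ k) := by
          rw [hΛs]; exact mul_le_mul hγs hLs (norm_nonneg _) (by positivity)
      _ ≤ (Cγ * (1 + ‖s‖) ^ K * Real.exp (-(π * |s.im|) / 2)) * (max CL 0 * (1 + ‖s‖) ^ k) := by
          gcongr
      _ = (max CL 0 * Cγ) * (1 + ‖s‖) ^ (k + K) * Real.exp (-(π * |s.im|) / 2) := by
          rw [pow_add]; ring
      _ ≤ (max CL 0 * Cγ + B' * Real.exp π) * (1 + ‖s‖) ^ (k + K) * Real.exp (-(π * |s.im|) / 2) := by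
          gcongr
          · linarith [show (0 : ℝ) ≤ B' * Real.exp π by positivity]
  · -- `|t| < 2`: compactness
    have hmem : s ∈ {z : ℂ | σ₁ ≤ z.re ∧ z.re ≤ σ₂ ∧ |z.im| ≤ 2} := ⟨hs1, hs2, ht.le⟩
    have hΛB : ‖Λ s‖ ≤ B' := (hB s hmem).trans (le_max_left _ _)
    have hexp : (1 : ℝ) ≤ Real.exp π * Real.exp (-(π * |s.im|) / 2) := by
      rw [← Real.exp_add]
      exact Real.one_le_exp (by nlinarith [Real.pi_pos, abs_nonneg s.im])
    have hone : (1 : ℝ) ≤ (1 + ‖s‖) ^ (k + K) := one_le_pow₀ h1s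
    calc ‖Λ s‖ ≤ B' := hΛB
      _ ≤ B' * ((1 + ‖s‖) ^ (k + K) * (Real.exp π * Real.exp (-(π * |s.im|) / 2))) :=
          le_mul_of_one_le_right (le_max_right _ _) (one_le_mul_of_one_le_of_one_le hone hexp)
      _ = (B' * Real.exp π) * (1 + ‖s‖) ^ (k + K) * Real.exp (-(π * |s.im|) / 2) := by ring
      _ ≤ (max CL 0 * Cγ + B' * Real.exp π) * (1 + ‖s‖) ^ (k + K) * Real.exp (-(π * |s.im|) / 2) := by
          gcongr
          · linarith [show (0 : ℝ) ≤ max CL 0 * Cγ by positivity]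

end Booker2003

end Literature.NumberTheory.Automorphic

end
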